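import Summits.PneNP.PneNP.Theorems.ChebyshevTracialDesignScalarTiltFixedDirection
import HarnessLib

/-!
# Cell pnp-psdrank, route `ChebyshevTracialDesign`: (PC) ON EDGE-TYPE FIELDS IS RECTANGLE DECAY OF THE QUADRATICALLY REWEIGHTED LEVEL KERNEL
# `W(U,M)·C_ν(U,M)²` — the corrected smallest open instance as an `r = 1`-shaped statement (brick 172; crux `TracialDecayExp20`, stmt-PneNP-19878)

Brick 172 (prover g33; MEMO-36 §2(f)). Notation: `x_p = 1[p ∈ U]`, `π_M` the partner map, and for a fixed pair weighting `ν : [n]² → ℝ` the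
TRANSPORTED CONTAINMENT STATISTIC `C_ν(U,M) := Σ_p ν(p, π_M p)·x_p x_{π_M p}` (`= 2·Σ_{e∈M, e⊆U} ν(e)` for symmetric `ν`). Brick 171 reduced the per-cut
statement (PC) on the edge-type fields `v_M(p) = h(M)·ν(p, π_M p)` (the corrected smallest open instance of the amplitude-one heart, MEMO-36 §2(c)) to
cube-positivity of virtual pinned-partner densities. THIS FILE gives the OTHER normal form: because the tilt `h` enters the per-cut value only through
`h(M)²` and LINEARLY, and the positive part over cuts is a sup over cut sets, the sup over all tilts `|h| ≤ 1` of the total positive per-cut value IS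
the sup over RECTANGLES `A × B` of the mass of the REWEIGHTED kernel `W(U,M)·C_ν(U,M)²`:
* §1 **`rect_reweighted_le_perCut_posPart`**: for every `A, B`: `Σ_{U∈A}Σ_{M∈B} W(U,M)·C_ν(U,M)² ≤ Σ_U (Σ_M W(U,M)·(1_B(M)·C_ν(U,M))²)₊` (the tilt
  `h = 1_B` realises the rectangle);
* §1 **`perCut_posPart_le_rect_reweighted`**: for every `|h| ≤ 1`, with the EXPLICIT rectangle `A⋆ = {U : per-cut value > 0}`,
  `B⋆ = {M : Σ_{U∈A⋆} W(U,M)C_ν(U,M)² > 0}`: `Σ_U (Σ_M W(U,M)·(h(M)·C_ν(U,M))²)₊ ≤ Σ_{U∈A⋆}Σ_{M∈B⋆} W(U,M)·C_ν(U,M)²` (drop `h² ≤ 1` on the matchings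
  where the `A⋆`-column sum is positive, drop the rest);
* §2 **`perCut_posPart_edgeField_le_of_rectangles`**: hence «`Σ_{U∈A}Σ_{M∈B} W·C_ν² ≤ ε` for all rectangles» ⟹ (PC) on every tilt of `ν∘π_M` with the
  same `ε` — (PC-ν) ⟺ NTF (the `r = 1` rung, all rectangles) FOR THE REWEIGHTED KERNEL `W·C_ν²`. For `ν` of vertex type (`ν(p,p') = u_p`) the kernel is
  `W·C_u²` with `C_u` virtually constant (bricks 105/170); for `ν ≡ 1` it is the level weight `W·(t − cc)²` (a modified design, brick 103); for a
  general signed `ν` it is the open statement, whose spread × spread main term is `−c·Σ_{A×B} C_ν² ≤ 0` (MEMO-36 §2(f): the Hadamard product of the two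
  pair-density Gram matrices is the Gram matrix of `C_ν` on `A × B`), so that what is missing is a TWO-SIDED relative spread lemma for doubly pinned
  sub-rectangles, not a new positivity phenomenon.
WHAT THIS FILE DOES NOT DO: prove the reweighted rectangle decay for any non-vertex `ν`; anything on `TracialDecayExp20` itself, psd rank of P_PM(K_n), or
P vs NP. [cite: Rothvoss2017, §2 and Lemma 7 (PDF pp. 6–8)] [cite: GriblingDelaatLaurent2019, §5] [cite: Grigoriev2001, Lemma 1.4 (PDF p. 8)]
Stature: support/instrument (kernel lane, no defs, axioms standard; pure bookkeeping). Supports stmt-PneNP-19878.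
-/

set_option linter.dupNamespace false -- `Summit.PneNP.PneNP.…`: summit = sub-problem (D-0017)

noncomputable section

namespace Summit.PneNP.PneNP.Theorems.ChebyshevTracialDesignReweightedRectangles

open Finset Literature.Barriers.PneNP Literature.Combinatorics.Optimization

variable {n : ℕ}

/-! ### §1 Tilts versus rectangles for the reweighted kernel -/

/-- Pulling a scalar tilt out of the transported containment statistic: `Σ_p (h·ν(p,πp))·x_px_{πp} = h·C_ν(U,M)`. [folklore] -/
theorem tilt_containment_eq (M : PMatch n) (U : OddSet n) (h : ℝ) (ν : Fin n → Fin n → ℝ) :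
    ∑ p, (h * ν p (M.2.partner p)) * ((if p ∈ U.1 then (1 : ℝ) else 0) * (if M.2.partner p ∈ U.1 then (1 : ℝ) else 0)) =
      h * ∑ p, ν p (M.2.partner p) * ((if p ∈ U.1 then (1 : ℝ) else 0) * (if M.2.partner p ∈ U.1 then (1 : ℝ) else 0)) := by
  rw [mul_sum]
  exact sum_congr rfl fun p _ => by ring

/-- **Every rectangle of the reweighted kernel is realised by a tilt.** For any weight `W`, pair weighting `ν` and sets `A`, `B`:
`Σ_{U∈A}Σ_{M∈B} W(U,M)·C_ν(U,M)² ≤ Σ_U (Σ_M W(U,M)·(1_B(M)·C_ν(U,M))²)₊`. [cite: Rothvoss2017, §2 (PDF p. 6)] -/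
theorem rect_reweighted_le_perCut_posPart (W : OddSet n → PMatch n → ℝ) (ν : Fin n → Fin n → ℝ)
    (A : Finset (OddSet n)) (B : Finset (PMatch n)) :
    ∑ U ∈ A, ∑ M ∈ B, W U M *
        (∑ p, ν p (M.2.partner p) * ((if p ∈ U.1 then (1 : ℝ) else 0) * (if M.2.partner p ∈ U.1 then (1 : ℝ) else 0))) ^ 2 ≤
      ∑ U : OddSet n, max (∑ M : PMatch n, W U M *
        (∑ p, ((if M ∈ B then (1 : ℝ) else 0) * ν p (M.2.partner p)) *
          ((if p ∈ U.1 then (1 : ℝ) else 0) * (if M.2.partner p ∈ U.1 then (1 : ℝ) else 0))) ^ 2) 0 := by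
  classical
  set Cn : OddSet n → PMatch n → ℝ := fun U M =>
    ∑ p, ν p (M.2.partner p) * ((if p ∈ U.1 then (1 : ℝ) else 0) * (if M.2.partner p ∈ U.1 then (1 : ℝ) else 0)) with hCn
  have htilt : ∀ (U : OddSet n) (M : PMatch n),
      (∑ p, ((if M ∈ B then (1 : ℝ) else 0) * ν p (M.2.partner p)) *
        ((if p ∈ U.1 then (1 : ℝ) else 0) * (if M.2.partner p ∈ U.1 then (1 : ℝ) else 0))) ^ 2 =
        (if M ∈ B then (1 : ℝ) else 0) * Cn U M ^ 2 := by
    intro U M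
    rw [tilt_containment_eq, mul_pow]
    congr 1
    split_ifs <;> norm_num
  have hcol : ∀ U : OddSet n, ∑ M : PMatch n, W U M * ((if M ∈ B then (1 : ℝ) else 0) * Cn U M ^ 2) =
      ∑ M ∈ B, W U M * Cn U M ^ 2 := by
    intro U
    rw [← sum_filter_add_sum_filter_not univ (fun M => M ∈ B)]
    have h1 : ∑ M ∈ univ.filter (fun M => M ∈ B), W U M * ((if M ∈ B then (1 : ℝ) else 0) * Cn U M ^ 2) = ∑ M ∈ B, W U M * Cn U M ^ 2 := by
      have hB : univ.filter (fun M : PMatch n => M ∈ B) = B := by ext M; simp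
      rw [hB]
      exact sum_congr rfl fun M hM => by rw [if_pos hM, one_mul]
    have h2 : ∑ M ∈ univ.filter (fun M => ¬ M ∈ B), W U M * ((if M ∈ B then (1 : ℝ) else 0) * Cn U M ^ 2) = 0 :=
      sum_eq_zero fun M hM => by rw [if_neg (mem_filter.1 hM).2]; ring
    rw [h1, h2, add_zero]
  change ∑ U ∈ A, ∑ M ∈ B, W U M * Cn U M ^ 2 ≤
    ∑ U : OddSet n, max (∑ M : PMatch n, W U M *
      (∑ p, ((if M ∈ B then (1 : ℝ) else 0) * ν p (M.2.partner p)) *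
        ((if p ∈ U.1 then (1 : ℝ) else 0) * (if M.2.partner p ∈ U.1 then (1 : ℝ) else 0))) ^ 2) 0
  simp_rw [htilt]
  calc ∑ U ∈ A, ∑ M ∈ B, W U M * Cn U M ^ 2 ≤ ∑ U ∈ A, max (∑ M ∈ B, W U M * Cn U M ^ 2) 0 :=
        sum_le_sum fun U _ => le_max_left _ _
    _ ≤ ∑ U, max (∑ M ∈ B, W U M * Cn U M ^ 2) 0 :=
        sum_le_sum_of_subset_of_nonneg (subset_univ A) fun U _ _ => le_max_right _ _
    _ = ∑ U, max (∑ M : PMatch n, W U M * ((if M ∈ B then (1 : ℝ) else 0) * Cn U M ^ 2)) 0 :=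
        sum_congr rfl fun U _ => by rw [hcol U]

/-- **Every tilt is dominated by an explicit rectangle of the reweighted kernel.** For any weight `W`, pair weighting `ν` and tilt `|h| ≤ 1`, with
`A⋆ = {U : Σ_M W(U,M)(h(M)C_ν(U,M))² > 0}` and `B⋆ = {M : Σ_{U∈A⋆} W(U,M)C_ν(U,M)² > 0}`:
`Σ_U (Σ_M W(U,M)·(h(M)·C_ν(U,M))²)₊ ≤ Σ_{U∈A⋆}Σ_{M∈B⋆} W(U,M)·C_ν(U,M)²`. [cite: Rothvoss2017, §2 and Lemma 7 (PDF pp. 6–8)] -/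
theorem perCut_posPart_le_rect_reweighted (W : OddSet n → PMatch n → ℝ) (ν : Fin n → Fin n → ℝ)
    (h : PMatch n → ℝ) (hh : ∀ M, |h M| ≤ 1) :
    ∑ U : OddSet n, max (∑ M : PMatch n, W U M *
        (∑ p, (h M * ν p (M.2.partner p)) * ((if p ∈ U.1 then (1 : ℝ) else 0) * (if M.2.partner p ∈ U.1 then (1 : ℝ) else 0))) ^ 2) 0 ≤
      ∑ U ∈ (univ.filter fun U : OddSet n => 0 < ∑ M : PMatch n, W U M *
          (∑ p, (h M * ν p (M.2.partner p)) * ((if p ∈ U.1 then (1 : ℝ) else 0) * (if M.2.partner p ∈ U.1 then (1 : ℝ) else 0))) ^ 2),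
        ∑ M ∈ (univ.filter fun M : PMatch n => 0 < ∑ U' ∈ (univ.filter fun U : OddSet n => 0 < ∑ M' : PMatch n, W U M' *
            (∑ p, (h M' * ν p (M'.2.partner p)) * ((if p ∈ U.1 then (1 : ℝ) else 0) * (if M'.2.partner p ∈ U.1 then (1 : ℝ) else 0))) ^ 2),
            W U' M * (∑ p, ν p (M.2.partner p) * ((if p ∈ U'.1 then (1 : ℝ) else 0) * (if M.2.partner p ∈ U'.1 then (1 : ℝ) else 0))) ^ 2),
          W U M * (∑ p, ν p (M.2.partner p) * ((if p ∈ U.1 then (1 : ℝ) else 0) * (if M.2.partner p ∈ U.1 then (1 : ℝ) else 0))) ^ 2 := by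
  classical
  set Cn : OddSet n → PMatch n → ℝ := fun U M =>
    ∑ p, ν p (M.2.partner p) * ((if p ∈ U.1 then (1 : ℝ) else 0) * (if M.2.partner p ∈ U.1 then (1 : ℝ) else 0)) with hCn
  have htilt : ∀ (U : OddSet n) (M : PMatch n),
      (∑ p, (h M * ν p (M.2.partner p)) * ((if p ∈ U.1 then (1 : ℝ) else 0) * (if M.2.partner p ∈ U.1 then (1 : ℝ) else 0))) ^ 2 =
        h M ^ 2 * Cn U M ^ 2 := by
    intro U M
    rw [tilt_containment_eq, mul_pow]
  set g : OddSet n → ℝ := fun U => ∑ M : PMatch n, W U M * (h M ^ 2 * Cn U M ^ 2) with hg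
  set A : Finset (OddSet n) := univ.filter fun U => 0 < g U with hA
  set G : PMatch n → ℝ := fun M => ∑ U ∈ A, W U M * Cn U M ^ 2 with hG
  set B : Finset (PMatch n) := univ.filter fun M => 0 < G M with hB
  have hh2 : ∀ M, 0 ≤ h M ^ 2 ∧ h M ^ 2 ≤ 1 := fun M => ⟨sq_nonneg _, (sq_le_one_iff_abs_le_one _).2 (hh M)⟩
  -- the statement, rewritten through the abbreviations
  have hgoal : ∑ U : OddSet n, max (g U) 0 ≤ ∑ U ∈ A, ∑ M ∈ B, W U M * Cn U M ^ 2 := by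
    -- positive parts over cuts = the sum over `A`
    have h1 : ∑ U : OddSet n, max (g U) 0 = ∑ U ∈ A, g U := by
      rw [← sum_filter_add_sum_filter_not univ (fun U => 0 < g U)]
      have hz : ∑ U ∈ univ.filter (fun U => ¬ 0 < g U), max (g U) 0 = 0 :=
        sum_eq_zero fun U hU => max_eq_right (not_lt.1 (mem_filter.1 hU).2)
      rw [hz, add_zero]
      exact sum_congr rfl fun U hU => max_eq_left (le_of_lt (mem_filter.1 hU).2)
    -- swap: Σ_{U∈A} g U = Σ_M h(M)² G(M)
    have h2 : ∑ U ∈ A, g U = ∑ M : PMatch n, h M ^ 2 * G M := by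
      rw [hg]
      dsimp only
      rw [sum_comm]
      refine sum_congr rfl fun M _ => ?_
      rw [hG, mul_sum]
      exact sum_congr rfl fun U _ => by ring
    -- drop `h² ≤ 1` where `G > 0`, drop the rest
    have h3 : ∑ M : PMatch n, h M ^ 2 * G M ≤ ∑ M ∈ B, G M := by
      rw [← sum_filter_add_sum_filter_not univ (fun M => 0 < G M)]
      have hneg : ∑ M ∈ univ.filter (fun M => ¬ 0 < G M), h M ^ 2 * G M ≤ 0 :=
        sum_nonpos fun M hM => mul_nonpos_iff.2 (Or.inl ⟨(hh2 M).1, not_lt.1 (mem_filter.1 hM).2⟩)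
      have hpos : ∑ M ∈ univ.filter (fun M => 0 < G M), h M ^ 2 * G M ≤ ∑ M ∈ B, G M :=
        sum_le_sum fun M hM => mul_le_of_le_one_left (le_of_lt (mem_filter.1 hM).2) (hh2 M).2
      linarith
    have h4 : ∑ M ∈ B, G M = ∑ U ∈ A, ∑ M ∈ B, W U M * Cn U M ^ 2 := by
      rw [sum_comm]
    calc ∑ U : OddSet n, max (g U) 0 = ∑ U ∈ A, g U := h1
      _ = ∑ M : PMatch n, h M ^ 2 * G M := h2
      _ ≤ ∑ M ∈ B, G M := h3
      _ = ∑ U ∈ A, ∑ M ∈ B, W U M * Cn U M ^ 2 := h4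
  -- unfold the abbreviations in the goal
  have hgU : ∀ U : OddSet n, ∑ M : PMatch n, W U M *
      (∑ p, (h M * ν p (M.2.partner p)) * ((if p ∈ U.1 then (1 : ℝ) else 0) * (if M.2.partner p ∈ U.1 then (1 : ℝ) else 0))) ^ 2 = g U := by
    intro U
    rw [hg]
    exact sum_congr rfl fun M _ => by rw [htilt]
  simp_rw [hgU]
  convert hgoal using 0

/-! ### §2 (PC) on edge-type fields from rectangle decay of the reweighted kernel -/

/-- **(PC-ν) ⟸ NTF FOR THE REWEIGHTED KERNEL.** If every rectangle has reweighted mass `Σ_{U∈A}Σ_{M∈B} W(U,M)·C_ν(U,M)² ≤ ε`, then every tilt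
`|h| ≤ 1` of the transported pair weighting has total positive per-cut value `Σ_U (Σ_M W(U,M)·C_{h·ν∘π_M}(U)²)₊ ≤ ε` (and conversely every rectangle
is a tilt, `rect_reweighted_le_perCut_posPart`). [cite: Rothvoss2017, §2 and Lemma 7 (PDF pp. 6–8)] [cite: GriblingDelaatLaurent2019, §5] -/
theorem perCut_posPart_edgeField_le_of_rectangles (W : OddSet n → PMatch n → ℝ) (ν : Fin n → Fin n → ℝ) {ε : ℝ}
    (hrect : ∀ (A : Finset (OddSet n)) (B : Finset (PMatch n)),
      ∑ U ∈ A, ∑ M ∈ B, W U M *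
        (∑ p, ν p (M.2.partner p) * ((if p ∈ U.1 then (1 : ℝ) else 0) * (if M.2.partner p ∈ U.1 then (1 : ℝ) else 0))) ^ 2 ≤ ε)
    (h : PMatch n → ℝ) (hh : ∀ M, |h M| ≤ 1) :
    ∑ U : OddSet n, max (∑ M : PMatch n, W U M *
        (∑ p, (h M * ν p (M.2.partner p)) * ((if p ∈ U.1 then (1 : ℝ) else 0) * (if M.2.partner p ∈ U.1 then (1 : ℝ) else 0))) ^ 2) 0 ≤ ε :=
  (perCut_posPart_le_rect_reweighted W ν h hh).trans (hrect _ _)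

end Summit.PneNP.PneNP.Theorems.ChebyshevTracialDesignReweightedRectangles
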